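import Literature.AnabelianGeometry.EtaleTheta.Discharge.Sec1Prop15QuotOfYCoordKit
import Literature.AnabelianGeometry.EtaleTheta.SettingModelTateProp15TruthTable
import Literature.AnabelianGeometry.EtaleTheta.SettingModelTateKummerDataFiltration
import Literature.AnabelianGeometry.EtaleTheta.SettingModelTateOriginShearRigidity
import Literature.AnabelianGeometry.EtaleTheta.SettingModelHasThetaTopology
import Literature.AnabelianGeometry.EtaleTheta.Discharge.Sec2RigidityAtModelTate
import HarnessLib

/-!
# [EtTh] Prop. 1.5 (i)(ii) «F¹/F² = Ẑ·log(U)», «F̈¹/F̈² = Ẑ·log(Ü)»: the root predicates `Prop15iQuot` / `Prop15iiQuot`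
# WITNESSED at the STAGE-2 (Tate-sheared) χ-model `modelχq p i j` — and ALL FIVE typed clauses of Prop. 1.5 at ONE datum

S. Mochizuki, *The étale theta function and its Frobenioid-theoretic manifestations*, Publ. RIMS **45** (2009) [EtTh],
§1, Prop. 1.5 (i)(ii)(iii), PRIMS PDF p. 23 (printed 249): «F¹/F² = Hom((Δ^tp_Y)^ell/Δ_Θ, Δ_Θ) = Ẑ·log(U)»,
«F̈¹/F̈² = … = Ẑ·log(Ü) … log(Ü) := ½·log(U)» [cite: MochizukiEtTh2009, Prop 1.5 (ii) p.23].

Layer L2 of the abc-iut cell, R78 cluster STAGE 2, seat abc-iut-L2-t6 (gen 7), row «PROP15-QUOT FROM A Y-COORDINATE KIT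
(generic) + STAGE-2 INSTANCES». PROOF-ONLY (0 definitions). At abc-iut-L2-t5's stage-2 record
`ThetaSetting.modelχq p i j hj` (`Π^tp_X := Γ ⋊_{(κ_p^i, κ_p^j, χ)} G_{ℚ_p}`, `j` even) the four KIT LAWS of
`Discharge/Sec1Prop15QuotOfYCoordKit` hold for abc-iut-w5-d171's F6q kit `yCoordKitχq p i j hj`:

* `yCoordKitχq_chiT_eq_one` — `χ^Θ = χ ∘ aug^Θ` is trivial on `(Δ^tp_X)^Θ` (`aug = 1` there);
* `yThetaχq_eq_one_iff_mem_deltaTheta_of_mem_dtpY` — on `(Δ^tp_Y)^Θ`, `ŷ = 1 ↔ ∈ Δ_Θ` (an element of `Δ^tp_Y` has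
  `Γ`-degree `0`, so all its `x`-levels vanish; `ŷ = 1` kills all `y`-levels; `⇐` is abc-iut-L2-t6 gen 6's
  `yThetaχq_eq_one_of_mem_deltaTheta`);
* `exists_mem_dtpY_y_eq`, `inl_bPowGfp_sq_mem_dtpYddN_one_modelχq`, `exists_mem_dtpYdd_y_eq_sq` — `inl(b^t) ∈ Δ^tp_Y`
  has `ŷ = t`, `inl(b^{s²}) ∈ Δ^tp_Ÿ` has `ŷ = s²` (the Tate shear does not touch `inl`-elements);
* `ι = deltaThetaCoordχq` is bijective (abc-iut-L6-d6).

RESULTS (every `i`, every even `j`, every `Compat` witness `hC`):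
* **`prop15iQuot_modelχq_of_logU_eq` / `prop15iiQuot_modelχq_of_logUdd_eq`** — `Prop15iQuot E hC` / `Prop15iiQuot E hC`
  for EVERY Kummer datum `E` of `modelχq` whose `log(U)` / `log(Ü)` is the kit class; instances **`prop15iQuot_kummerDataχq`**,
  **`prop15iiQuot_kummerDataχq`** (F6q data, `rfl`), **`prop15iQuot_ofSection_modelχq` / `prop15iiQuot_ofSection_modelχq`**
  (every section datum `(kummerCoreχq …).toKummerDataOfSection s …`, `rfl`), `hL_ofSection_modelχq`, `hL_kummerDataχq`,
  `htf_modelχq`;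
* **`prop15_all_five_inrSection_modelχq`** — at `(i, j) = (1, 2)`, at abc-iut-L2-t12's `inr`-section datum of the truth
  table (`SettingModelTateProp15TruthTable`): Prop. 1.5 (i) ∧ (ii) ∧ (iii) ∧ (i)-Quot ∧ (ii)-Quot — ALL FIVE typed clauses
  of Prop. 1.5 hold TOGETHER at ONE étale-theta datum; census `exists_etaleThetaData_prop15_all_five_modelχq` and the root
  form **`ThetaSetting.exists_isEtThOrigin_and_isTateOrigin_and_prop15_all_five`**; stage-2 NV for every `(i, j)`:
  `ThetaSetting.exists_isEtThOrigin_prop15iQuot_and_prop15iiQuot_stage2`.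
HONEST FRAMING: SEMI-SYNTHETIC model — consistency / non-vacuity evidence for the typed interface ONLY; nothing of [EtTh]
is asserted; typed ≠ proved; no side is taken on [IUTchIII] Cor. 3.12.
-/

noncomputable section

namespace Literature.AnabelianGeometry.EtaleTheta.SettingModel

open Literature.AnabelianGeometry.SemiGraphs _root_.Function

variable (p : ℕ) [Fact p.Prime] (i j : ℤ) (hj : Even j)

/-! ### Kit law 1: `χ^Θ` is trivial on `(Δ^tp_X)^Θ` -/

/-- **`χ^Θ(g) = 1` for `g ∈ (Δ^tp_X)^Θ`** at `modelχq` (`χ^Θ = χ ∘ aug^Θ`, `aug^Θ = 1` on the image of `Δ^tp_X = Ker aug`).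
[cite: MochizukiEtTh2009, §1 p.12] -/
theorem yCoordKitχq_chiT_eq_one {g : CurveTheta.GTheta (curveχq p i j)}
    (hg : g ∈ (ThetaSetting.modelχq p i j hj).DeltaTemp.map (ThetaSetting.modelχq p i j hj).toTheta) :
    (yCoordKitχq p i j hj).chiT g = 1 := by
  obtain ⟨g₀, hg₀, rfl⟩ := hg
  have hright : g₀.right = 1 := (mem_deltaTempχq_iff p i j g₀).mp hg₀
  show chi p (CurveTheta.augTheta (curveχq p i j) (CurveTheta.toTheta (curveχq p i j) g₀)) = 1
  rw [CurveTheta.augTheta_toTheta]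
  show chi p (augχq p i j g₀) = 1
  rw [augχq_apply, hright, map_one]

/-! ### Kit law 2: on `(Δ^tp_Y)^Θ`, `ŷ = 1 ↔ ∈ Δ_Θ` -/

/-- **On `(Δ^tp_Y)^Θ`: `ŷ(x) = 1 ↔ x ∈ Δ_Θ`** at `modelχq` (`⇒`: an element of `Δ^tp_Y` has `Γ`-degree `0` and trivial
Galois part, so all `x`-levels vanish, and `ŷ = 1` kills all `y`-levels; `⇐`: `yThetaχq_eq_one_of_mem_deltaTheta`).
[cite: MochizukiEtTh2009, Prop 1.5 (i) p.23] -/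
theorem yThetaχq_eq_one_iff_mem_deltaTheta_of_mem_dtpY {x : CurveTheta.GTheta (curveχq p i j)}
    (hx : x ∈ (ThetaSetting.modelχq p i j hj).DtpYTheta) :
    yThetaχq p i j x = 1 ↔ x ∈ (ThetaSetting.modelχq p i j hj).DeltaTheta := by
  refine ⟨fun h => ?_, fun h => yThetaχq_eq_one_of_mem_deltaTheta p i j h⟩
  obtain ⟨g, hg, rfl⟩ := hx
  have hY : g ∈ (ThetaSetting.modelχq p i j hj).GtpY := (Subgroup.mem_inf.mp hg).1
  have hright : g.right = 1 := (mem_deltaTempχq_iff p i j g).mp (Subgroup.mem_inf.mp hg).2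
  have hx0 : gfpSnd g.left = 1 := gfpSnd_left_eq_one_of_mem_gtpY_modelχq p i j hj hY
  rw [yThetaχq_toTheta] at h
  change CurveTheta.toTheta (curveχq p i j) g ∈ (CurveTheta.thetaToEll (curveχq p i j)).ker
  rw [CurveTheta.mk_mem_ker_thetaToEll_iff, mem_ellKerχq_iff]
  refine ⟨fun N => ⟨levelHom_x_eq_zero hx0, ?_⟩, hright⟩
  rw [hHat_y_eq_zero_iff]
  change modN N (yCoordχq p i j g) = 1
  rw [h, map_one]

/-- Kit law 2 in kit form. [cite: MochizukiEtTh2009, Prop 1.5 (i) p.23] -/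
theorem yCoordKitχq_ker_law :
    ∀ g ∈ (ThetaSetting.modelχq p i j hj).DtpYTheta,
      (yCoordKitχq p i j hj).y g = 1 ↔ g ∈ (ThetaSetting.modelχq p i j hj).DeltaTheta :=
  fun _ hg => yThetaχq_eq_one_iff_mem_deltaTheta_of_mem_dtpY p i j hj hg

/-! ### Kit law 3: `ŷ` is onto `Ẑ` on `(Δ^tp_Y)^Θ` and onto the squares on `(Δ^tp_Ÿ)^Θ` -/

/-- **`inl(b^t) ∈ Δ^tp_Y` with `ŷ = t`**: every `t ∈ Ẑ` is a `y`-coordinate on `(Δ^tp_Y)^Θ`. [cite: MochizukiEtTh2009, §1 p.12] -/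
theorem exists_mem_dtpY_y_eq (t : ZH) :
    ∃ g ∈ (ThetaSetting.modelχq p i j hj).DtpYTheta, (yCoordKitχq p i j hj).y g = t :=
  ⟨CurveTheta.toTheta (curveχq p i j) (SemidirectProduct.inl (bPowGfp t)),
    Subgroup.mem_map_of_mem _ (inl_bPowGfp_mem_dtpYqj p i j hj t), yCoordKitχq_y_inl_bPowGfp p i j hj t⟩

/-- **`inl(b^{s²}) ∈ Δ^tp_Ÿ`** at `modelχq`: `Γ`-degree `0`, level-`2` `y`-coordinate `2s ≡ 0`, trivial Galois part
(`K̈ = K_2 = ℚ_p` here). [cite: MochizukiEtTh2009, §1 p.17] -/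
theorem inl_bPowGfp_sq_mem_dtpYddN_one_modelχq (s : ZH) :
    (SemidirectProduct.inl (bPowGfp (s ^ 2)) : PiTpχq p i j) ∈ (ThetaSetting.modelχq p i j hj).DtpYddN 1 := by
  have hy : (hHat 2 (gfpFst (bPowGfp (s ^ 2)))).y = 0 := by
    rw [hHat_y_eq_zero_iff, gfpFst_bPowGfp, eHatB_bPow]
    exact (mem_range_sqHom_iff _).mp ⟨s, rfl⟩
  exact Subgroup.mem_inf.mpr
    ⟨mem_GtpYdd_modelχq_of_hHat_two_y p i j hj (inl_bPowGfp_mem_GtpY_modelχq p i j hj _) hy,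
      inl_mem_deltaTempχq p i j _⟩

/-- **`inl(b^{s²}) ∈ Δ^tp_Ÿ` with `ŷ = s²`**: every square is a `y`-coordinate on `(Δ^tp_Ÿ)^Θ`.
[cite: MochizukiEtTh2009, Prop 1.5 (ii) p.23] -/
theorem exists_mem_dtpYdd_y_eq_sq (s : ZH) :
    ∃ g ∈ ((ThetaSetting.modelχq p i j hj).DtpYddN 1).map (ThetaSetting.modelχq p i j hj).toTheta,
      (yCoordKitχq p i j hj).y g = s ^ 2 :=
  ⟨CurveTheta.toTheta (curveχq p i j) (SemidirectProduct.inl (bPowGfp (s ^ 2))),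
    Subgroup.mem_map_of_mem _ (inl_bPowGfp_sq_mem_dtpYddN_one_modelχq p i j hj s),
    yCoordKitχq_y_inl_bPowGfp p i j hj (s ^ 2)⟩

-- Kit law 4 (`ι = deltaThetaCoordχq` bijective) is abc-iut-L6-d6's `bijective_deltaThetaCoordχq`
-- (kit form `yCoordKitχq_iota_bijective` already landed in `Discharge/Sec1Rmk131ModelTate`; used here by value).

/-! ### Prop. 1.5 (i)/(ii) «= Ẑ·log» at the stage-2 model -/

/-- **[EtTh] Prop. 1.5 (i) «F¹/F² = Ẑ·log(U)» at `modelχq`** for EVERY Kummer datum whose `log(U)` is the F6q kit class.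
[cite: MochizukiEtTh2009, Prop 1.5 (i) p.23] -/
theorem prop15iQuot_modelχq_of_logU_eq (hC : (ThetaSetting.modelχq p i j hj).Compat)
    {E : (ThetaSetting.modelχq p i j hj).KummerData} (hE : E.logU = (yCoordKitχq p i j hj).logU) :
    ThetaSetting.Prop15iQuot E hC :=
  (yCoordKitχq p i j hj).prop15iQuot_of_laws hC (hasThetaTopology_modelχq p i j hj)
    (ThetaSetting.modelχq_isEtThOrigin p i j hj) (fun _ hg => yCoordKitχq_chiT_eq_one p i j hj hg)
    (yCoordKitχq_ker_law p i j hj) (exists_mem_dtpY_y_eq p i j hj) (bijective_deltaThetaCoordχq p i j) hE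

/-- **[EtTh] Prop. 1.5 (ii) «F̈¹/F̈² = Ẑ·log(Ü)» at `modelχq`** for EVERY Kummer datum whose `log(Ü)` is the F6q kit class.
[cite: MochizukiEtTh2009, Prop 1.5 (ii) p.23] -/
theorem prop15iiQuot_modelχq_of_logUdd_eq (hC : (ThetaSetting.modelχq p i j hj).Compat)
    {E : (ThetaSetting.modelχq p i j hj).KummerData} (hE : E.logUdd = (yCoordKitχq p i j hj).logUdd) :
    ThetaSetting.Prop15iiQuot E hC :=
  (yCoordKitχq p i j hj).prop15iiQuot_of_laws hC (hasThetaTopology_modelχq p i j hj)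
    (ThetaSetting.modelχq_isEtThOrigin p i j hj) (fun _ hg => yCoordKitχq_chiT_eq_one p i j hj hg)
    ((yCoordKitχq p i j hj).ker_law_Ydd_of_Y (yCoordKitχq_ker_law p i j hj)) (exists_mem_dtpYdd_y_eq_sq p i j hj)
    (bijective_deltaThetaCoordχq p i j) hE

/-- **Prop. 1.5 (i)-Quot at the F6q Kummer data `kummerDataχq`** (their `log(U)` IS the kit class).
[cite: MochizukiEtTh2009, Prop 1.5 (i) p.23] -/
theorem prop15iQuot_kummerDataχq (hC : (ThetaSetting.modelχq p i j hj).Compat) :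
    ThetaSetting.Prop15iQuot (kummerDataχq p i j hj) hC :=
  prop15iQuot_modelχq_of_logU_eq p i j hj hC rfl

/-- **Prop. 1.5 (ii)-Quot at the F6q Kummer data `kummerDataχq`.** [cite: MochizukiEtTh2009, Prop 1.5 (ii) p.23] -/
theorem prop15iiQuot_kummerDataχq (hC : (ThetaSetting.modelχq p i j hj).Compat) :
    ThetaSetting.Prop15iiQuot (kummerDataχq p i j hj) hC :=
  prop15iiQuot_modelχq_of_logUdd_eq p i j hj hC rfl

section OfSection

variable {p i j hj}
variable (s : GQp p →* PiTpχq p i j) (hs : Continuous s)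
  (hsec : ∀ σ, (ThetaSetting.modelχq p i j hj).aug (s σ) = σ)
  (hsY : (ThetaSetting.modelχq p i j hj).GK.map s ≤ (ThetaSetting.modelχq p i j hj).GtpY)
  (hsYdd : (ThetaSetting.modelχq p i j hj).GKdd.map s ≤ (ThetaSetting.modelχq p i j hj).GtpYdd)

/-- **Prop. 1.5 (i)-Quot for EVERY section Kummer datum of the F6q core** (its `log(U)` is the kit class, `rfl`).
[cite: MochizukiEtTh2009, Prop 1.5 (i) p.23] -/
theorem prop15iQuot_ofSection_modelχq (hC : (ThetaSetting.modelχq p i j hj).Compat) :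
    ThetaSetting.Prop15iQuot ((kummerCoreχq p i j hj).toKummerDataOfSection s hs hsec hsY hsYdd) hC :=
  prop15iQuot_modelχq_of_logU_eq p i j hj hC rfl

/-- **Prop. 1.5 (ii)-Quot for EVERY section Kummer datum of the F6q core** (its `log(Ü)` is the kit class, `rfl`).
[cite: MochizukiEtTh2009, Prop 1.5 (ii) p.23] -/
theorem prop15iiQuot_ofSection_modelχq (hC : (ThetaSetting.modelχq p i j hj).Compat) :
    ThetaSetting.Prop15iiQuot ((kummerCoreχq p i j hj).toKummerDataOfSection s hs hsec hsY hsYdd) hC :=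
  prop15iiQuot_modelχq_of_logUdd_eq p i j hj hC rfl

/-- **`hL` at the stage-2 section data**: `log(Ü)^n ∈ F̈² → n = 0`. [cite: MochizukiEtTh2009, Prop 1.5 (ii) p.23] -/
theorem hL_ofSection_modelχq (hC : (ThetaSetting.modelχq p i j hj).Compat) {n : ℤ}
    (hn : ((kummerCoreχq p i j hj).toKummerDataOfSection s hs hsec hsY hsYdd).logUdd ^ n ∈
      (ThetaSetting.Fdd2 : Subgroup ((ThetaSetting.modelχq p i j hj).H1Theta
        ((ThetaSetting.modelχq p i j hj).GtpYdd.map (ThetaSetting.modelχq p i j hj).toTheta)))) : n = 0 :=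
  (prop15iiQuot_ofSection_modelχq s hs hsec hsY hsYdd hC).hL_of_origin (ThetaSetting.modelχq_isEtThOrigin p i j hj) hn

end OfSection

/-- **`htf` at the stage-2 model**: `d ∈ F̈¹`, `d² ∈ F̈²` ⇒ `d ∈ F̈²` (a statement about the filtration of `modelχq` alone;
from `prop15iiQuot_kummerDataχq`). [cite: MochizukiEtTh2009, Prop 1.5 (ii) p.23] -/
theorem htf_modelχq (hC : (ThetaSetting.modelχq p i j hj).Compat)
    {d : (ThetaSetting.modelχq p i j hj).H1Theta
      ((ThetaSetting.modelχq p i j hj).GtpYdd.map (ThetaSetting.modelχq p i j hj).toTheta)}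
    (hd : d ∈ ThetaSetting.Fdd1 hC)
    (hsq : d * d ∈ (ThetaSetting.Fdd2 : Subgroup ((ThetaSetting.modelχq p i j hj).H1Theta
      ((ThetaSetting.modelχq p i j hj).GtpYdd.map (ThetaSetting.modelχq p i j hj).toTheta)))) :
    d ∈ (ThetaSetting.Fdd2 : Subgroup ((ThetaSetting.modelχq p i j hj).H1Theta
      ((ThetaSetting.modelχq p i j hj).GtpYdd.map (ThetaSetting.modelχq p i j hj).toTheta))) :=
  (prop15iiQuot_kummerDataχq p i j hj hC).htf_of_origin (ThetaSetting.modelχq_isEtThOrigin p i j hj) hd hsq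

/-- **`hL` at the F6q data**: `log(Ü)^n ∈ F̈² → n = 0`. [cite: MochizukiEtTh2009, Prop 1.5 (ii) p.23] -/
theorem hL_kummerDataχq (hC : (ThetaSetting.modelχq p i j hj).Compat) {n : ℤ}
    (hn : (kummerDataχq p i j hj).logUdd ^ n ∈
      (ThetaSetting.Fdd2 : Subgroup ((ThetaSetting.modelχq p i j hj).H1Theta
        ((ThetaSetting.modelχq p i j hj).GtpYdd.map (ThetaSetting.modelχq p i j hj).toTheta)))) : n = 0 :=
  (prop15iiQuot_kummerDataχq p i j hj hC).hL_of_origin (ThetaSetting.modelχq_isEtThOrigin p i j hj) hn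


/-- **Stage-2 NV for every `(i, j)`**: some theta setting of [EtTh] origin carries a `Compat` witness and a Kummer datum
for which BOTH identifications «F¹/F² = Ẑ·log(U)» and «F̈¹/F̈² = Ẑ·log(Ü)» hold. [cite: MochizukiEtTh2009, Prop 1.5 (ii) p.23] -/
theorem _root_.Literature.AnabelianGeometry.EtaleTheta.ThetaSetting.exists_isEtThOrigin_prop15iQuot_and_prop15iiQuot_stage2
    (i j : ℤ) (hj : Even j) :
    ∃ (D : ThetaSetting p) (hC : D.Compat) (E : D.KummerData),
      D.IsEtThOrigin ∧ ThetaSetting.Prop15iQuot E hC ∧ ThetaSetting.Prop15iiQuot E hC :=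
  ⟨ThetaSetting.modelχq p i j hj, compat_modelχq p i j hj, kummerDataχq p i j hj,
    ThetaSetting.modelχq_isEtThOrigin p i j hj, prop15iQuot_kummerDataχq p i j hj _, prop15iiQuot_kummerDataχq p i j hj _⟩

/-! ### ALL FIVE typed clauses of Prop. 1.5 at ONE datum of `modelχq p 1 2` -/

/-- **THE FULL TRUTH TABLE AT STAGE 2: Prop. 1.5 (i) ∧ (ii) ∧ (iii) ∧ (i)-Quot ∧ (ii)-Quot hold TOGETHER** at the
étale-theta datum of `η̈♯ = etaDdχq` over abc-iut-L2-t12's `inr`-section Kummer datum of `modelχq p 1 2` ((i)(ii)(iii) =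
`prop15_i_ii_iii_inrSection_modelχq`; the two «= Ẑ·log» identifications = this file). [cite: MochizukiEtTh2009, Prop 1.5 p.23] -/
theorem prop15_all_five_inrSection_modelχq (hC : (ThetaSetting.modelχq p 1 2 even_two).Compat) :
    ThetaSetting.Prop15i ((kummerCoreχq p 1 2 even_two).toKummerDataOfSection SemidirectProduct.inr
        (continuous_inrχq p 1 2) (fun _ => rfl) (map_inr_GK_le_GtpY_modelχq' p 1 2 even_two)
        (map_inr_GKdd_le_GtpYdd_modelχq' p 1 2 even_two)) hC ∧
      ThetaSetting.Prop15ii ((kummerCoreχq p 1 2 even_two).toKummerDataOfSection SemidirectProduct.inr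
        (continuous_inrχq p 1 2) (fun _ => rfl) (map_inr_GK_le_GtpY_modelχq' p 1 2 even_two)
        (map_inr_GKdd_le_GtpYdd_modelχq' p 1 2 even_two)) hC ∧
      ThetaSetting.Prop15iii (((kummerCoreχq p 1 2 even_two).toKummerDataOfSection SemidirectProduct.inr
        (continuous_inrχq p 1 2) (fun _ => rfl) (map_inr_GK_le_GtpY_modelχq' p 1 2 even_two)
        (map_inr_GKdd_le_GtpYdd_modelχq' p 1 2 even_two)).etaleThetaDataOfClass (etaDdχq p 1 2 even_two)) hC ∧
      ThetaSetting.Prop15iQuot ((kummerCoreχq p 1 2 even_two).toKummerDataOfSection SemidirectProduct.inr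
        (continuous_inrχq p 1 2) (fun _ => rfl) (map_inr_GK_le_GtpY_modelχq' p 1 2 even_two)
        (map_inr_GKdd_le_GtpYdd_modelχq' p 1 2 even_two)) hC ∧
      ThetaSetting.Prop15iiQuot ((kummerCoreχq p 1 2 even_two).toKummerDataOfSection SemidirectProduct.inr
        (continuous_inrχq p 1 2) (fun _ => rfl) (map_inr_GK_le_GtpY_modelχq' p 1 2 even_two)
        (map_inr_GKdd_le_GtpYdd_modelχq' p 1 2 even_two)) hC :=
  have h3 := prop15_i_ii_iii_inrSection_modelχq p hC
  ⟨h3.1, h3.2.1, h3.2.2, prop15iQuot_ofSection_modelχq _ _ _ _ _ hC, prop15iiQuot_ofSection_modelχq _ _ _ _ _ hC⟩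

/-- **CENSUS (stage 2, all five)**: `modelχq p 1 2` carries an étale-theta datum `T` with `T.etaDd = etaDdχq` whose Kummer
data satisfy Prop. 1.5 (i) ∧ (ii) ∧ (i)-Quot ∧ (ii)-Quot and which satisfies Prop. 1.5 (iii) — for every `hC`.
[cite: MochizukiEtTh2009, Prop 1.5 p.23] -/
theorem exists_etaleThetaData_prop15_all_five_modelχq (hC : (ThetaSetting.modelχq p 1 2 even_two).Compat) :
    ∃ T : (ThetaSetting.modelχq p 1 2 even_two).EtaleThetaData,
      T.etaDd = etaDdχq p 1 2 even_two ∧ ThetaSetting.Prop15i T.toKummerData hC ∧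
        ThetaSetting.Prop15ii T.toKummerData hC ∧ ThetaSetting.Prop15iii T hC ∧
          ThetaSetting.Prop15iQuot T.toKummerData hC ∧ ThetaSetting.Prop15iiQuot T.toKummerData hC :=
  ⟨((kummerCoreχq p 1 2 even_two).toKummerDataOfSection SemidirectProduct.inr
        (continuous_inrχq p 1 2) (fun _ => rfl) (map_inr_GK_le_GtpY_modelχq' p 1 2 even_two)
        (map_inr_GKdd_le_GtpYdd_modelχq' p 1 2 even_two)).etaleThetaDataOfClass (etaDdχq p 1 2 even_two),
    rfl, prop15_all_five_inrSection_modelχq p hC⟩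

/-- **Root-level census form (all five)**: SOME theta setting satisfying the §1 guard `IsEtThOrigin` AND the Tate clause
`IsTateOrigin` carries an étale-theta datum on which ALL FIVE typed clauses of Prop. 1.5 hold at `compat` — the frozen
`Prop15i` ∧ `Prop15ii` ∧ `Prop15iii` (F-2502 ∧ F-2503 ∧ F-0591) AND abc-iut-L2-t1's identifications `Prop15iQuot` ∧
`Prop15iiQuot` («F¹/F² = Ẑ·log(U)», «F̈¹/F̈² = Ẑ·log(Ü)») are jointly satisfiable with the origin clauses; witness the
Tate-sheared model at `(i, j) = (1, 2)`. [cite: MochizukiEtTh2009, Prop 1.5 p.23] -/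
theorem _root_.Literature.AnabelianGeometry.EtaleTheta.ThetaSetting.exists_isEtThOrigin_and_isTateOrigin_and_prop15_all_five :
    ∃ D : ThetaSetting p, D.IsEtThOrigin ∧ D.IsTateOrigin ∧ ∃ T : D.EtaleThetaData,
      ThetaSetting.Prop15i T.toKummerData D.compat ∧ ThetaSetting.Prop15ii T.toKummerData D.compat ∧
        ThetaSetting.Prop15iii T D.compat ∧ ThetaSetting.Prop15iQuot T.toKummerData D.compat ∧
          ThetaSetting.Prop15iiQuot T.toKummerData D.compat :=
  ⟨ThetaSetting.modelχq p 1 2 even_two, ThetaSetting.modelχq_isEtThOrigin p 1 2 even_two, modelχq_isTateOrigin p 1,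
    ((kummerCoreχq p 1 2 even_two).toKummerDataOfSection SemidirectProduct.inr
        (continuous_inrχq p 1 2) (fun _ => rfl) (map_inr_GK_le_GtpY_modelχq' p 1 2 even_two)
        (map_inr_GKdd_le_GtpYdd_modelχq' p 1 2 even_two)).etaleThetaDataOfClass (etaDdχq p 1 2 even_two),
    prop15_all_five_inrSection_modelχq p _⟩

end Literature.AnabelianGeometry.EtaleTheta.SettingModel

end
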